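import Mathlib.Analysis.SpecialFunctions.Log.Basic
import Mathlib.Analysis.Complex.Exponential
import Mathlib.Analysis.Complex.ExponentialBounds
import Mathlib.Analysis.Real.Pi.Bounds
import Mathlib.Tactic.LinearCombination

/-!
# Stub `stub_assemble40` of line `Sketch`, crux `WeilComb.CombShapePositivity` — by an explicit linear combination
(item stmt-RiemannHypothesis-11229, route route-RiemannHypothesis-WeilComb; siege k3, variation
"linear combination by hand from the four bounds")

The registered stub `stub_assemble40` of skeleton v7 (`Cruxes/CombShapePositivity/Lines/Sketch.lean`) is the
pure real-arithmetic budget of the effective subcritical window `εM ≤ 1/40`: the exact decomposition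
`Re Q = ReP − U·H + (L·Wd + Off)` (`U = ε⁻¹N` the unit, `H = V − D` the Helson form) together with the FOUR
one-sided bounds — pole `ReP`, archimedean diagonal `Wd`, archimedean off-diagonal `Off`, Helson potential
`V` — and the Poincaré transfer `(1 + log M)Q₁ ≤ Q' + ML`, `Q' ≤ (1+η)MD + (1+1/η)(23/20)ML` forces `0 ≤ Re Q`.

Proof shape (this file): after passing to the unit `U` (`N = εU`), each of the four bounds is normalised BY HAND
to a polynomial inequality with rational coefficients in the monomials `U·D`, `U·L`, `ε·U·L`, `εM·U·L`, `εM·U·D`,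
`ε·U·(1 + log M)Q₁` (constants: `e^ε ≤ 513/500`, `(1 − (e^{4ε} − 1)M/2)⁻¹ ≤ 200/189`, `21/(5π) ≤ 7/5`,
`log 10 > 9/4`), and the conclusion is ONE explicit linear combination with nonnegative rational coefficients,
checked by `linear_combination` (the certificate is spelled out; no search):
`ReQ = pole + off + L·diag + U·(Helson) + (11191/3500)·εU·(Poincaré) + (7942323/700000)·UL·(εM ≤ 1/40)
  + (123101/3500)·UD·(εM ≤ 1/40) + (14/5)·UL·(ε ≤ 1/40) + (16899/140000)·UD + (3257677/28000000)·UL`,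
i.e. the window closes at `λ = 1/40` with margins `0.1207·U·D + 0.1163·U·L`.
-/

noncomputable section

-- the sub-problem path `RiemannHypothesis/RiemannHypothesis` (single-conjunct summit, D-0017) duplicates a namespace
set_option linter.dupNamespace false

namespace Summit.RiemannHypothesis.RiemannHypothesis.Theorems.WeilCombBohrFejer.SiegeK3

/-- `9/4 < log 10`, from `e⁹ < 2.7182818286⁹ < 10⁴`. [folklore] -/
theorem nine_fourths_lt_log_ten : (9 / 4 : ℝ) < Real.log 10 := by
  rw [Real.lt_log_iff_exp_lt (by norm_num)]
  have h1 : Real.exp (9 / 4) ^ 4 = Real.exp 1 ^ 9 := by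
    rw [← Real.exp_nat_mul, ← Real.exp_nat_mul]
    norm_num
  have h2 : Real.exp 1 ^ 9 < (10 : ℝ) ^ 4 := by
    calc Real.exp 1 ^ 9 ≤ (2.7182818286 : ℝ) ^ 9 := by gcongr; exact Real.exp_one_lt_d9.le
      _ < (10 : ℝ) ^ 4 := by norm_num
  rw [← h1] at h2
  exact lt_of_pow_lt_pow_left₀ 4 (by norm_num) h2

/-- **Stub S5 (`stub_assemble40`) — the budget of the effective window `εM ≤ 1/40`, by one explicit linear
combination of the four bounds.** With `U = ε⁻¹N`, `λ = εM ≤ 1/40`, `A = 1 + log M`, `X = εAQ₁`: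
pole `ReP ≥ −(513/500)·εU·(4ML + AQ₁)`, off-diagonal `Off ≥ −(76/35)·U·X`,
diagonal `Wd ≥ U(log M + 5/4) − (14/5)εU`, Helson `V ≤ (log M + 39/50)L`,
Poincaré (`η = 10`) `AQ₁ ≤ 11MD + (453/200)ML`; summing with the displayed nonnegative weights leaves
`(16899/140000)·UD + (3257677/28000000)·UL ≥ 0`. [folklore] -/
theorem stub_assemble40 : ∀ {ε Mr N I L D Qp Q1 V H ReQ ReP Wd Off F0 F1 nAm nAp : ℝ},
    0 < ε → 1 ≤ Mr → ε * Mr ≤ 1 / 40 →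
    0 < N → 0 < I → I ^ 2 ≤ 2 * N →
    0 ≤ L → 0 ≤ D → 0 ≤ Qp → 0 ≤ Q1 →
    (Real.log Mr + 1) * Q1 ≤ Qp + Mr * L →
    (∀ η : ℝ, 0 < η → Qp ≤ (1 + η) * Mr * D + (1 + 1 / η) * (23 / 20) * Mr * L) →
    V ≤ (Real.log Mr + 39 / 50) * L → H = V - D →
    ReQ = ReP - ε⁻¹ * N * H + (L * Wd + Off) →
    0 ≤ F0 → 0 ≤ F1 → F0 ≤ Real.exp (ε / 2) * I → F1 ≤ Real.exp (ε / 2) * I →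
    0 ≤ nAm → 0 ≤ nAp → nAm ^ 2 ≤ (1 + Real.log Mr) * L → nAp ^ 2 ≤ Mr * Q1 →
    -(2 * (F0 * F1 * (nAm * nAp))) ≤ ReP →
    ε⁻¹ * N * (Real.log (ε⁻¹ * N / (2 * I ^ 2)) - 1) - 21 / (5 * Real.pi) * I ^ 2 ≤ Wd →
    -(I ^ 2 * Real.exp ε * (1 - (Real.exp (4 * ε) - 1) * Mr / 2)⁻¹ * (1 + Real.log Mr) * Q1) ≤ Off →
    0 ≤ ReQ := by
  intro ε Mr N I L D Qp Q1 V H ReQ ReP Wd Off F0 F1 nAm nAp hε hM hlam hN hI hI2 hL hD _hQp hQ1 hQ1le hPoinc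
    hV hH hQ _hF0 hF1 hF0le hF1le hnAm hnAp hnAm2 hnAp2 hP hWd hOff
  subst hH hQ
  /- ### Units: `N = εU`, `U = ε⁻¹N > 0` -/
  obtain ⟨U, hU, rfl⟩ : ∃ U : ℝ, 0 < U ∧ N = ε * U :=
    ⟨ε⁻¹ * N, by positivity, (mul_inv_cancel_left₀ hε.ne' N).symm⟩
  rw [inv_mul_cancel_left₀ hε.ne'] at hWd ⊢
  -- elementary ranges
  have hMr0 : 0 < Mr := by linarith only [hM]
  have hε40 : ε ≤ 1 / 40 := by nlinarith only [hlam, hM, hε]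
  have hA0 : 0 < 1 + Real.log Mr := by linarith only [Real.log_nonneg hM]
  /- ### Constants: `e^ε ≤ 513/500`, `κ = (1 − (e^{4ε}−1)M/2)⁻¹ ∈ (0, 200/189]` -/
  have hE0 : Real.exp ε ≤ 513 / 500 := by
    -- `e^ε ≤ 1 + ε + ε²` (`|ε| ≤ 1`)
    have h := (abs_le.1 (Real.abs_exp_sub_one_sub_id_le (x := ε)
      (by rw [abs_of_pos hε]; linarith only [hε40]))).2
    nlinarith only [h, hε40, hε]
  have ht : (Real.exp (4 * ε) - 1) * Mr ≤ 11 / 100 := by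
    -- `e^{4ε} − 1 ≤ 4ε + 16ε²` (`|4ε| ≤ 1`), `εM ≤ 1/40`, `ε·εM ≤ 1/1600`
    have h := (abs_le.1 (Real.abs_exp_sub_one_sub_id_le (x := 4 * ε)
      (by rw [abs_of_pos (by positivity)]; linarith only [hε40]))).2
    have h1 : (Real.exp (4 * ε) - 1) * Mr ≤ (4 * ε + (4 * ε) ^ 2) * Mr :=
      mul_le_mul_of_nonneg_right (by linarith only [h]) hMr0.le
    have h2 : ε * (ε * Mr) ≤ 1 / 40 * (1 / 40) := mul_le_mul hε40 hlam (by positivity) (by norm_num)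
    linarith only [h1, h2, hlam]
  have hκpos : 0 < (1 - (Real.exp (4 * ε) - 1) * Mr / 2)⁻¹ := inv_pos.2 (by linarith only [ht])
  have hκ : (1 - (Real.exp (4 * ε) - 1) * Mr / 2)⁻¹ ≤ 200 / 189 := by
    have h := inv_anti₀ (by norm_num : (0 : ℝ) < 189 / 200)
      (show (189 / 200 : ℝ) ≤ 1 - (Real.exp (4 * ε) - 1) * Mr / 2 by linarith only [ht])
    rwa [inv_div] at h
  /- ### Bound 1 (pole): `ReP ≥ −(513/500)·εU·(4ML + AQ₁)` -/
  have hFF : F0 * F1 ≤ Real.exp ε * I ^ 2 := by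
    calc F0 * F1 ≤ (Real.exp (ε / 2) * I) * (Real.exp (ε / 2) * I) :=
          mul_le_mul hF0le hF1le hF1 (by positivity)
      _ = Real.exp (ε / 2 + ε / 2) * I ^ 2 := by rw [Real.exp_add]; ring
      _ = Real.exp ε * I ^ 2 := by rw [add_halves]
  have hxy : 4 * (nAm * nAp) ≤ 4 * Mr * L + (1 + Real.log Mr) * Q1 := by
    -- weighted AM–GM: `(2M x − A y)² ≥ 0`, `x² ≤ AL`, `y² ≤ MQ₁`, then cancel `MA > 0`
    have hsq : 0 ≤ (2 * Mr * nAm - (1 + Real.log Mr) * nAp) ^ 2 := sq_nonneg _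
    have h1 : 4 * Mr ^ 2 * nAm ^ 2 ≤ 4 * Mr ^ 2 * ((1 + Real.log Mr) * L) :=
      mul_le_mul_of_nonneg_left hnAm2 (by positivity)
    have h2 : (1 + Real.log Mr) ^ 2 * nAp ^ 2 ≤ (1 + Real.log Mr) ^ 2 * (Mr * Q1) :=
      mul_le_mul_of_nonneg_left hnAp2 (by positivity)
    refine le_of_mul_le_mul_left ?_ (mul_pos hMr0 hA0)
    linear_combination hsq + h1 + h2
  have hB3 : -(513 / 500 * (ε * U) * (4 * Mr * L + (1 + Real.log Mr) * Q1)) ≤ ReP := by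
    have h1 : F0 * F1 * (nAm * nAp) ≤ Real.exp ε * I ^ 2 * (nAm * nAp) :=
      mul_le_mul_of_nonneg_right hFF (mul_nonneg hnAm hnAp)
    have h2 : Real.exp ε * I ^ 2 ≤ 513 / 500 * (2 * (ε * U)) :=
      mul_le_mul hE0 hI2 (by positivity) (by norm_num)
    have h3 : Real.exp ε * I ^ 2 * (4 * (nAm * nAp)) ≤
        513 / 500 * (2 * (ε * U)) * (4 * Mr * L + (1 + Real.log Mr) * Q1) :=
      mul_le_mul h2 hxy (by positivity) (by positivity)
    linear_combination hP + 2 * h1 + h3 / 2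
  /- ### Bound 2 (off-diagonal): `Off ≥ −2·(513/500)(200/189)·εU·AQ₁` -/
  have hB4 : -(2 * (ε * U) * (513 / 500) * (200 / 189) * (1 + Real.log Mr) * Q1) ≤ Off := by
    have h1 : I ^ 2 * Real.exp ε ≤ 2 * (ε * U) * (513 / 500) :=
      mul_le_mul hI2 hE0 (Real.exp_pos ε).le (by positivity)
    have h2 : I ^ 2 * Real.exp ε * (1 - (Real.exp (4 * ε) - 1) * Mr / 2)⁻¹ ≤
        2 * (ε * U) * (513 / 500) * (200 / 189) :=
      mul_le_mul h1 hκ hκpos.le (by positivity)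
    have h3 := mul_le_mul_of_nonneg_right (mul_le_mul_of_nonneg_right h2 hA0.le) hQ1
    linear_combination hOff + h3
  /- ### Bound 3 (diagonal): `Wd ≥ U(log M + 9/4 − 1) − (14/5)εU` -/
  have hWd' : U * (Real.log Mr + 5 / 4) - 14 / 5 * (ε * U) ≤ Wd := by
    have hquot : 10 * Mr ≤ U / (2 * I ^ 2) := by
      rw [le_div_iff₀ (by positivity)]
      calc 10 * Mr * (2 * I ^ 2) ≤ 10 * Mr * (2 * (2 * (ε * U))) :=
            mul_le_mul_of_nonneg_left (by linarith only [hI2]) (by positivity)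
        _ = 40 * (ε * Mr) * U := by ring
        _ ≤ 1 * U := mul_le_mul_of_nonneg_right (by linarith only [hlam]) hU.le
        _ = U := one_mul U
    have hlog : Real.log Mr + 9 / 4 ≤ Real.log (U / (2 * I ^ 2)) := by
      have h1 := Real.log_le_log (by positivity) hquot
      rw [Real.log_mul (by norm_num) hMr0.ne'] at h1
      linarith only [h1, nine_fourths_lt_log_ten]
    have hjunk : 21 / (5 * Real.pi) * I ^ 2 ≤ 14 / 5 * (ε * U) := by
      have h1 : 21 / (5 * Real.pi) ≤ 7 / 5 := by
        rw [div_le_iff₀ (by positivity)]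
        linarith only [Real.pi_gt_three]
      calc 21 / (5 * Real.pi) * I ^ 2 ≤ 7 / 5 * I ^ 2 := mul_le_mul_of_nonneg_right h1 (sq_nonneg I)
        _ ≤ 7 / 5 * (2 * (ε * U)) := by linarith only [hI2]
        _ = 14 / 5 * (ε * U) := by ring
    have h2 : U * (Real.log Mr + 5 / 4) ≤ U * (Real.log (U / (2 * I ^ 2)) - 1) :=
      mul_le_mul_of_nonneg_left (by linarith only [hlog]) hU.le
    linarith only [hWd, h2, hjunk]
  /- ### Bound 4 (Helson) is `hV` itself; Poincaré transfer at `η = 10` -/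
  have hAQ1 : (1 + Real.log Mr) * Q1 ≤ 11 * Mr * D + 453 / 200 * Mr * L := by
    have h := hPoinc 10 (by norm_num)
    linarith only [h, hQ1le]
  /- ### The linear combination (by hand; all weights nonnegative, residue zero) -/
  linear_combination hB3 + hB4 + L * hWd' + U * hV + (11191 / 3500 * (ε * U)) * hAQ1
    + (7942323 / 700000 * (U * L)) * hlam + (123101 / 3500 * (U * D)) * hlam
    + (14 / 5 * (U * L)) * hε40
    + (16899 / 140000 : ℝ) * mul_nonneg hU.le hD + (3257677 / 28000000 : ℝ) * mul_nonneg hU.le hL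

end Summit.RiemannHypothesis.RiemannHypothesis.Theorems.WeilCombBohrFejer.SiegeK3

end
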